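import Mathlib.Analysis.SpecialFunctions.Pow.Integral
import Mathlib.Analysis.SpecialFunctions.Integrals.Basic
import Literature.Analysis.FunctionSpaces.FourierSobolevNormEmbeddingProofs
import HarnessLib

/-!
# Tools for the subcritical Sobolev embeddings `Ḣ^s(ℝ³) ⊂ L^{6/(3−2s)}(ℝ³)`, `0 < s < 3/2`
# (Bahouri–Chemin–Danchin 2011, Thm. 1.38 with `d = 3`): power cut-offs, layer cake, ball integrals

Topic `Analysis/FunctionSpaces`; support file of `FourierSobolevNormEmbeddingSubcritical.lean`, which assembles
Bahouri–Chemin–Danchin 2011, Thm. 1.38 for `d = 3` and every `0 < s < 3/2` from the lemmas here; sibling of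
`FourierSobolevNormEmbeddingProofs.lean` (the case `s = 1/2`, whose `s`-independent lemmas
`SobolevEmbeddingHalf.exists_high_frequency_part` / `volume_norm_gt_le` are reused, not restated). Theorems only;
no definitions, no named facts, no `sorry`. The frequency-splitting proof of Chemin–Xu 1997 (Introduction, (5)
via (8)–(10), pp. 722–724) run with a general exponent needs, beyond the `s = 1/2` file:

1. `lintegral_Ioc_rpow` — `∫_{0<t≤L} t^q dt = L^{q+1}/(q+1)` (`q > −1`) in `[0, ∞]`;
2. `lintegral_Ioi_rpow_lintegral_compl_ball` — the Fubini–Tonelli step with the power-law cut-off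
   `A_t = (t/(2m))^γ`: `∫_{t>0} t^q ∫_{‖ξ‖ ≥ A_t} H dξ dt = ((2m)^{q+1}/(q+1)) ∫ ‖ξ‖^{(q+1)/γ} H`;
3. `lintegral_enorm_rpow_le` — the layer-cake step for a general exponent `p > 2`;
4. `lintegral_unitBall_rpow_neg_ne_top` / `_pos`, `lintegral_ball_rpow_neg_eq` — in dimension `3`:
   `∫_{B(0,A)} ‖ξ‖^{−2s} dξ = A^{3−2s} J_s` with `0 < J_s = ∫_{‖ξ‖<1} ‖ξ‖^{−2s} < ∞` (`0 ≤ s < 3/2`);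
5. `lintegral_ball_enorm_le(_mul)` — the Cauchy–Schwarz low-frequency bound
   `∫_{‖ξ‖<A} ‖G‖ ≤ A^{(3−2s)/2} J_s^{1/2} (∫ ‖ξ‖^{2s} ‖G‖²)^{1/2}`.

## References

* [BahouriCheminDanchin2011] H. Bahouri, J.-Y. Chemin, R. Danchin, *Fourier Analysis and Nonlinear Partial
  Differential Equations*, Grundlehren 343, Springer (2011), Def. 1.31, Thm. 1.38.
* [CheminXu1997] J.-Y. Chemin, C.-J. Xu, *Inclusions de Sobolev en calcul de Weyl–Hörmander et champs de
  vecteurs sous-elliptiques*, Ann. Sci. École Norm. Sup. (4) 30 (1997) 719–751, Introduction pp. 722–724,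
  (5), (8)–(10).
-/

noncomputable section

open MeasureTheory SchwartzMap FourierTransform Complex Set Filter
open scoped ENNReal NNReal Topology Real

namespace Literature.Analysis.FunctionSpaces

namespace SobolevEmbeddingSub

open SobolevEmbeddingHalf (exists_high_frequency_part volume_norm_gt_le)

/-! ## The power integral and the Tonelli step with a power-law cut-off -/

section FourierInv

variable {V : Type*} [NormedAddCommGroup V] [InnerProductSpace ℝ V] [FiniteDimensional ℝ V]
  [MeasurableSpace V] [BorelSpace V]
variable {F : Type*} [NormedAddCommGroup F] [InnerProductSpace ℂ F] [CompleteSpace F]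

/-- `∫_{0 < t ≤ L} t^q dt = L^{q+1}/(q+1)` for `q > −1`, `L ≥ 0`, as an integral in `[0, ∞]` (the `t`-integral of
the Fubini–Tonelli step of Chemin–Xu 1997, proof of (5)). [cite: CheminXu1997, Introduction, proof of (5), p. 724] -/
theorem lintegral_Ioc_rpow {q L : ℝ} (hq : -1 < q) (hL : 0 ≤ L) :
    ∫⁻ t in Ioc 0 L, ENNReal.ofReal (t ^ q) = ENNReal.ofReal (L ^ (q + 1) / (q + 1)) := by
  have hint : IntervalIntegrable (fun t : ℝ => t ^ q) volume 0 L := intervalIntegral.intervalIntegrable_rpow' hq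
  have h1 : ∫ t in Ioc 0 L, t ^ q = L ^ (q + 1) / (q + 1) := by
    rw [← intervalIntegral.integral_of_le hL, integral_rpow (Or.inl hq), Real.zero_rpow (by linarith),
      sub_zero]
  rw [← h1, ofReal_integral_eq_lintegral_ofReal hint.1]
  rw [EventuallyLE, ae_restrict_iff' measurableSet_Ioc]
  exact Eventually.of_forall fun t ht => Real.rpow_nonneg ht.1.le q

omit [CompleteSpace F] in
/-- **Fubini–Tonelli step with a power-law cut-off** (Chemin–Xu 1997, end of the proof of (5), p. 724, for a
general exponent): for `m, γ > 0`, `q > −1` and a.e.-measurable `H ≥ 0`,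
`∫_{t>0} t^q ∫_{‖ξ‖ ≥ (t/(2m))^γ} H(ξ) dξ dt = ((2m)^{q+1}/(q+1)) ∫ ‖ξ‖^{(q+1)/γ} H(ξ) dξ`.
[cite: CheminXu1997, Introduction, proof of (5), p. 724] -/
theorem lintegral_Ioi_rpow_lintegral_compl_ball {H : V → ℝ≥0∞} (hH : AEMeasurable H volume) {m γ q : ℝ}
    (hm : 0 < m) (hγ : 0 < γ) (hq : -1 < q) :
    ∫⁻ t in Ioi (0 : ℝ), ENNReal.ofReal (t ^ q) * ∫⁻ ξ in (Metric.ball (0 : V) ((t / (2 * m)) ^ γ))ᶜ, H ξ =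
      ENNReal.ofReal ((2 * m) ^ (q + 1) / (q + 1)) * ∫⁻ ξ, ‖ξ‖ₑ ^ ((q + 1) / γ) * H ξ := by
  set S : Set (ℝ × V) := {p | p.1 ≤ 2 * m * ‖p.2‖ ^ γ⁻¹} with hS
  have hSm : MeasurableSet S :=
    measurableSet_le measurable_fst (((measurable_snd.norm).pow_const _).const_mul _)
  set Kf : ℝ × V → ℝ≥0∞ := S.indicator fun p => ENNReal.ofReal (p.1 ^ q) * H p.2 with hKf
  have hKm : AEMeasurable Kf ((volume.restrict (Ioi (0 : ℝ))).prod volume) :=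
    (((ENNReal.measurable_ofReal.comp (measurable_fst.pow_const q)).aemeasurable).mul hH.comp_snd).indicator
      hSm
  -- membership in the cut-off region
  have hiff : ∀ t ∈ Ioi (0 : ℝ), ∀ ξ : V,
      ξ ∈ (Metric.ball (0 : V) ((t / (2 * m)) ^ γ))ᶜ ↔ (t, ξ) ∈ S := by
    intro t ht ξ
    have ht' : 0 < t := ht
    have h2m : 0 < 2 * m := by positivity
    rw [Set.mem_compl_iff, mem_ball_zero_iff, not_lt, hS, Set.mem_setOf_eq]
    have hkey : (t / (2 * m)) ^ γ ≤ ‖ξ‖ ↔ t / (2 * m) ≤ ‖ξ‖ ^ γ⁻¹ := by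
      rw [← Real.rpow_le_rpow_iff (z := γ) (by positivity) (Real.rpow_nonneg (norm_nonneg _) _) hγ,
        Real.rpow_inv_rpow (norm_nonneg _) hγ.ne']
    rw [hkey, div_le_iff₀ h2m, mul_comm]
  have hinner : ∀ t ∈ Ioi (0 : ℝ),
      ENNReal.ofReal (t ^ q) * ∫⁻ ξ in (Metric.ball (0 : V) ((t / (2 * m)) ^ γ))ᶜ, H ξ = ∫⁻ ξ, Kf (t, ξ) := by
    intro t ht
    rw [← lintegral_indicator measurableSet_ball.compl, ← lintegral_const_mul' _ _ ENNReal.ofReal_ne_top]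
    refine lintegral_congr fun ξ => ?_
    by_cases hξ : ξ ∈ (Metric.ball (0 : V) ((t / (2 * m)) ^ γ))ᶜ
    · rw [indicator_of_mem hξ, hKf, indicator_of_mem ((hiff t ht ξ).1 hξ)]
    · rw [indicator_of_notMem hξ, hKf, indicator_of_notMem (mt (hiff t ht ξ).2 hξ), mul_zero]
  have houter : ∀ ξ : V, ∫⁻ t in Ioi (0 : ℝ), Kf (t, ξ) =
      H ξ * ENNReal.ofReal ((2 * m * ‖ξ‖ ^ γ⁻¹) ^ (q + 1) / (q + 1)) := by
    intro ξ
    have hpt : ∀ t : ℝ, Kf (t, ξ) =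
        (Iic (2 * m * ‖ξ‖ ^ γ⁻¹)).indicator (fun t => ENNReal.ofReal (t ^ q) * H ξ) t := by
      intro t
      by_cases ht : t ∈ Iic (2 * m * ‖ξ‖ ^ γ⁻¹)
      · rw [indicator_of_mem ht, hKf, indicator_of_mem (show (t, ξ) ∈ S from ht)]
      · rw [indicator_of_notMem ht, hKf, indicator_of_notMem (show (t, ξ) ∉ S from ht)]
    simp_rw [hpt]
    have hmf : Measurable (fun a : ℝ => ENNReal.ofReal (a ^ q)) :=
      ENNReal.measurable_ofReal.comp (measurable_id.pow_const q)
    rw [lintegral_indicator measurableSet_Iic, Measure.restrict_restrict measurableSet_Iic, Set.Iic_inter_Ioi,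
      lintegral_mul_const _ hmf, lintegral_Ioc_rpow hq (by positivity), mul_comm]
  have hexp : ∀ ξ : V, ENNReal.ofReal ((2 * m * ‖ξ‖ ^ γ⁻¹) ^ (q + 1) / (q + 1)) =
      ENNReal.ofReal ((2 * m) ^ (q + 1) / (q + 1)) * ‖ξ‖ₑ ^ ((q + 1) / γ) := by
    intro ξ
    have hq1 : 0 < q + 1 := by linarith
    rw [Real.mul_rpow (by positivity) (Real.rpow_nonneg (norm_nonneg _) _), ← Real.rpow_mul (norm_nonneg _),
      show γ⁻¹ * (q + 1) = (q + 1) / γ by rw [div_eq_mul_inv, mul_comm],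
      show (2 * m) ^ (q + 1) * ‖ξ‖ ^ ((q + 1) / γ) / (q + 1) = (2 * m) ^ (q + 1) / (q + 1) * ‖ξ‖ ^ ((q + 1) / γ)
        by ring,
      ENNReal.ofReal_mul (by positivity), ← ENNReal.ofReal_rpow_of_nonneg (norm_nonneg _) (by positivity),
      ofReal_norm]
  calc ∫⁻ t in Ioi (0 : ℝ), ENNReal.ofReal (t ^ q) * ∫⁻ ξ in (Metric.ball (0 : V) ((t / (2 * m)) ^ γ))ᶜ, H ξ
      = ∫⁻ t in Ioi (0 : ℝ), ∫⁻ ξ, Kf (t, ξ) := setLIntegral_congr_fun measurableSet_Ioi hinner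
    _ = ∫⁻ ξ, ∫⁻ t in Ioi (0 : ℝ), Kf (t, ξ) :=
        lintegral_lintegral_swap (f := fun t ξ => Kf (t, ξ))
          (by
            have huc : (Function.uncurry fun t ξ => Kf (t, ξ)) = Kf := by
              funext p
              rfl
            rw [huc]
            exact hKm)
    _ = ∫⁻ ξ, H ξ * ENNReal.ofReal ((2 * m * ‖ξ‖ ^ γ⁻¹) ^ (q + 1) / (q + 1)) := lintegral_congr houter
    _ = ∫⁻ ξ, ENNReal.ofReal ((2 * m) ^ (q + 1) / (q + 1)) * (‖ξ‖ₑ ^ ((q + 1) / γ) * H ξ) := by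
        refine lintegral_congr fun ξ => ?_
        rw [hexp]
        ring
    _ = ENNReal.ofReal ((2 * m) ^ (q + 1) / (q + 1)) * ∫⁻ ξ, ‖ξ‖ₑ ^ ((q + 1) / γ) * H ξ :=
        lintegral_const_mul' _ _ ENNReal.ofReal_ne_top

/-- **Layer-cake step with a general exponent** (Chemin–Xu 1997, proof of (5)): if for every `t > 0` the
distribution function of `f ∈ L²` satisfies `vol{‖f‖ > t} ≤ (t/2)⁻² ∫_{‖ξ‖ ≥ (t/(2m))^γ} ‖𝓕f‖²` (`m, γ > 0`), then
for every `p > 2`: `∫ ‖f‖^p = p ∫₀^∞ t^{p−1} vol{‖f‖ > t} dt ≤ (4p (2m)^{p−2}/(p−2)) ∫ ‖ξ‖^{(p−2)/γ} ‖𝓕f(ξ)‖² dξ`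
(Mathlib `lintegral_rpow_eq_lintegral_meas_lt_mul` and the Tonelli step).
[cite: CheminXu1997, Introduction, proof of (5), pp. 723–724] -/
theorem lintegral_enorm_rpow_le (f₂ : Lp F 2 (volume : Measure V)) {m γ p : ℝ} (hm : 0 < m) (hγ : 0 < γ)
    (hp : 2 < p)
    (hdist : ∀ t : ℝ, 0 < t → volume {x | t < ‖(f₂ : V → F) x‖} ≤
      (ENNReal.ofReal (t / 2) ^ 2)⁻¹ *
        ∫⁻ ξ in (Metric.ball (0 : V) ((t / (2 * m)) ^ γ))ᶜ,
          ‖((𝓕 f₂ : Lp F 2 (volume : Measure V)) : V → F) ξ‖ₑ ^ 2) :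
    ∫⁻ x, ‖(f₂ : V → F) x‖ₑ ^ p ≤
      ENNReal.ofReal (4 * p * ((2 * m) ^ (p - 2) / (p - 2))) *
        ∫⁻ ξ, ‖ξ‖ₑ ^ ((p - 2) / γ) * ‖((𝓕 f₂ : Lp F 2 (volume : Measure V)) : V → F) ξ‖ₑ ^ 2 := by
  set G : V → F := ((𝓕 f₂ : Lp F 2 (volume : Measure V)) : V → F) with hG_def
  have hGm : AEStronglyMeasurable G volume := Lp.aestronglyMeasurable _
  have hp0 : 0 < p := by linarith
  -- layer cake
  have hlc := lintegral_rpow_eq_lintegral_meas_lt_mul volume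
    (f := fun x => ‖(f₂ : V → F) x‖) (Eventually.of_forall fun x => norm_nonneg _)
    (Lp.aestronglyMeasurable f₂).norm.aemeasurable (p := p) hp0
  have hlhs : ∫⁻ x, ‖(f₂ : V → F) x‖ₑ ^ p = ∫⁻ x, ENNReal.ofReal (‖(f₂ : V → F) x‖ ^ p) := by
    refine lintegral_congr fun x => ?_
    rw [← ofReal_norm, ENNReal.ofReal_rpow_of_nonneg (norm_nonneg _) hp0.le]
  rw [hlhs, hlc]
  -- pointwise bound of the integrand in `t`
  have hpt : ∀ t ∈ Ioi (0 : ℝ),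
      volume {x | t < ‖(f₂ : V → F) x‖} * ENNReal.ofReal (t ^ (p - 1)) ≤
        4 * (ENNReal.ofReal (t ^ (p - 3)) * ∫⁻ ξ in (Metric.ball (0 : V) ((t / (2 * m)) ^ γ))ᶜ, ‖G ξ‖ₑ ^ 2) := by
    intro t ht
    have ht' : (0 : ℝ) < t := ht
    have h4 : (ENNReal.ofReal (t / 2) ^ 2)⁻¹ * ENNReal.ofReal (t ^ (p - 1)) = 4 * ENNReal.ofReal (t ^ (p - 3)) := by
      rw [← ENNReal.ofReal_pow (by positivity), ← ENNReal.ofReal_inv_of_pos (by positivity),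
        ← ENNReal.ofReal_mul (by positivity), show (4 : ℝ≥0∞) = ENNReal.ofReal 4 by norm_num,
        ← ENNReal.ofReal_mul (by norm_num)]
      congr 1
      have e : t ^ (p - 1) = t ^ (p - 3) * t ^ (2 : ℝ) := by
        rw [← Real.rpow_add ht']
        congr 1
        ring
      rw [e, Real.rpow_two]
      field_simp
      ring
    calc volume {x | t < ‖(f₂ : V → F) x‖} * ENNReal.ofReal (t ^ (p - 1))
        ≤ ((ENNReal.ofReal (t / 2) ^ 2)⁻¹ * ∫⁻ ξ in (Metric.ball (0 : V) ((t / (2 * m)) ^ γ))ᶜ,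
            ‖G ξ‖ₑ ^ 2) * ENNReal.ofReal (t ^ (p - 1)) := by
          gcongr
          exact hdist t ht'
      _ = (ENNReal.ofReal (t / 2) ^ 2)⁻¹ * ENNReal.ofReal (t ^ (p - 1)) *
            ∫⁻ ξ in (Metric.ball (0 : V) ((t / (2 * m)) ^ γ))ᶜ, ‖G ξ‖ₑ ^ 2 := by ring
      _ = 4 * (ENNReal.ofReal (t ^ (p - 3)) * ∫⁻ ξ in (Metric.ball (0 : V) ((t / (2 * m)) ^ γ))ᶜ,
            ‖G ξ‖ₑ ^ 2) := by rw [h4, mul_assoc]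
  have hT := lintegral_Ioi_rpow_lintegral_compl_ball (V := V) (H := fun ξ => ‖G ξ‖ₑ ^ 2)
    (hGm.enorm.pow_const _) hm hγ (q := p - 3) (by linarith)
  have e1 : p - 3 + 1 = p - 2 := by ring
  rw [e1] at hT
  calc ENNReal.ofReal p * ∫⁻ t in Ioi 0, volume {x | t < ‖(f₂ : V → F) x‖} * ENNReal.ofReal (t ^ (p - 1))
      ≤ ENNReal.ofReal p * ∫⁻ t in Ioi 0,
          4 * (ENNReal.ofReal (t ^ (p - 3)) * ∫⁻ ξ in (Metric.ball (0 : V) ((t / (2 * m)) ^ γ))ᶜ,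
            ‖G ξ‖ₑ ^ 2) := by
        gcongr ENNReal.ofReal p * ?_
        exact setLIntegral_mono' measurableSet_Ioi hpt
    _ = ENNReal.ofReal p * (4 * (ENNReal.ofReal ((2 * m) ^ (p - 2) / (p - 2)) *
          ∫⁻ ξ, ‖ξ‖ₑ ^ ((p - 2) / γ) * ‖G ξ‖ₑ ^ 2)) := by
        rw [lintegral_const_mul' _ _ (by norm_num), hT]
    _ = ENNReal.ofReal (4 * p * ((2 * m) ^ (p - 2) / (p - 2))) * ∫⁻ ξ, ‖ξ‖ₑ ^ ((p - 2) / γ) * ‖G ξ‖ₑ ^ 2 := by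
        rw [← mul_assoc, ← mul_assoc, show (4 : ℝ≥0∞) = ENNReal.ofReal 4 by norm_num,
          ← ENNReal.ofReal_mul hp0.le, ← ENNReal.ofReal_mul (by positivity)]
        congr 2
        ring

end FourierInv

/-! ## Dimension three: `∫_{B(0,A)} ‖ξ‖^{−2s} dξ = A^{3−2s} J_s` and the low-frequency bound -/

section BallThree

/-- `J_s = ∫_{‖ξ‖<1} ‖ξ‖^{−2s} dξ < ∞` in `ℝ³` for `2s < 3 = dim` (Mathlib `integrableOn_ball_of_norm_le_rpow`): the
finiteness of the constant in (9) of Chemin–Xu 1997 for `d = 3`, `s < d/2`. [cite: CheminXu1997, Introduction (9), p. 723] -/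
theorem lintegral_unitBall_rpow_neg_ne_top {s : ℝ} (hs : s < 3 / 2) :
    (∫⁻ ξ in Metric.ball (0 : EuclideanSpace ℝ (Fin 3)) 1, ‖ξ‖ₑ ^ (-(2 * s))) ≠ ∞ := by
  have hint : IntegrableOn (fun ξ : EuclideanSpace ℝ (Fin 3) => ‖ξ‖ ^ (-(2 * s))) (Metric.ball 0 1) volume := by
    refine integrableOn_ball_of_norm_le_rpow (by rw [finrank_euclideanSpace_fin]; norm_num)
      (C := 1) (α := 2 * s) (by rw [finrank_euclideanSpace_fin]; push_cast; linarith)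
      (Eventually.of_forall fun ξ => ?_) ((measurable_norm.pow_const _).aestronglyMeasurable)
    rw [Real.norm_of_nonneg (Real.rpow_nonneg (norm_nonneg _) _), one_mul]
  have h : ∫⁻ ξ in Metric.ball (0 : EuclideanSpace ℝ (Fin 3)) 1, ‖(‖ξ‖ ^ (-(2 * s)) : ℝ)‖ₑ < ∞ := hint.2
  refine (lt_of_le_of_lt (lintegral_mono_ae ?_) h).ne
  have h0 : ∀ᵐ ξ ∂(volume : Measure (EuclideanSpace ℝ (Fin 3))), ξ ≠ 0 := by
    rw [ae_iff]; simp [measure_singleton]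
  filter_upwards [ae_restrict_of_ae h0] with ξ hξ
  rw [Real.enorm_eq_ofReal (Real.rpow_nonneg (norm_nonneg _) _),
    ← ENNReal.ofReal_rpow_of_pos (norm_pos_iff.2 hξ), ofReal_norm]

/-- `0 < J_s = ∫_{‖ξ‖<1} ‖ξ‖^{−2s} dξ` for `s ≥ 0` (the integrand is `≥ 1` on the unit ball, which has positive
measure): the constant in (9) of Chemin–Xu 1997 is nondegenerate. [cite: CheminXu1997, Introduction (9), p. 723] -/
theorem lintegral_unitBall_rpow_neg_pos {s : ℝ} (hs : 0 ≤ s) :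
    0 < ∫⁻ ξ in Metric.ball (0 : EuclideanSpace ℝ (Fin 3)) 1, ‖ξ‖ₑ ^ (-(2 * s)) := by
  have h1 : ∫⁻ _ in Metric.ball (0 : EuclideanSpace ℝ (Fin 3)) 1, (1 : ℝ≥0∞) ≤
      ∫⁻ ξ in Metric.ball (0 : EuclideanSpace ℝ (Fin 3)) 1, ‖ξ‖ₑ ^ (-(2 * s)) := by
    refine setLIntegral_mono' measurableSet_ball fun ξ hξ => ?_
    rw [ENNReal.rpow_neg, ENNReal.one_le_inv]
    refine ENNReal.rpow_le_one ?_ (by positivity)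
    rw [← ofReal_norm, ← ENNReal.ofReal_one]
    exact ENNReal.ofReal_le_ofReal (le_of_lt (by simpa using hξ))
  refine lt_of_lt_of_le ?_ h1
  rw [setLIntegral_const, one_mul]
  exact Metric.measure_ball_pos volume _ one_pos

/-- Scaling in `ℝ³`: `∫_{‖ξ‖<A} ‖ξ‖^{−2s} dξ = A^{3−2s} ∫_{‖ξ‖<1} ‖ξ‖^{−2s} dξ` for `A > 0` (substitution `ξ = A η`,
`dξ = A³ dη`; Mathlib `Measure.map_addHaar_smul`): the computation `∫_{B(0,A)} ‖ξ‖^{−2s} dξ = C A^{d−2s}` behind (9)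
of Chemin–Xu 1997 for `d = 3`. [cite: CheminXu1997, Introduction (9), p. 723] -/
theorem lintegral_ball_rpow_neg_eq {s A : ℝ} (hA : 0 < A) :
    ∫⁻ ξ in Metric.ball (0 : EuclideanSpace ℝ (Fin 3)) A, ‖ξ‖ₑ ^ (-(2 * s)) =
      ENNReal.ofReal (A ^ (3 - 2 * s)) * ∫⁻ ξ in Metric.ball (0 : EuclideanSpace ℝ (Fin 3)) 1, ‖ξ‖ₑ ^ (-(2 * s)) := by
  set h : EuclideanSpace ℝ (Fin 3) → ℝ≥0∞ :=
    (Metric.ball (0 : EuclideanSpace ℝ (Fin 3)) 1).indicator fun η => ‖η‖ₑ ^ (-(2 * s)) with hh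
  have hmeas : Measurable h := (measurable_enorm.pow_const _).indicator measurableSet_ball
  have hsm : Measurable fun ξ : EuclideanSpace ℝ (Fin 3) => A⁻¹ • ξ := measurable_id.const_smul A⁻¹
  have hAs : ENNReal.ofReal (A ^ (-(2 * s))) * ENNReal.ofReal (A ^ (2 * s)) = 1 := by
    rw [← ENNReal.ofReal_mul (Real.rpow_nonneg hA.le _), Real.rpow_neg hA.le,
      inv_mul_cancel₀ (Real.rpow_pos_of_pos hA _).ne', ENNReal.ofReal_one]
  have hpt : ∀ ξ : EuclideanSpace ℝ (Fin 3),
      (Metric.ball (0 : EuclideanSpace ℝ (Fin 3)) A).indicator (fun ξ => ‖ξ‖ₑ ^ (-(2 * s))) ξ =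
        ENNReal.ofReal (A ^ (-(2 * s))) * h (A⁻¹ • ξ) := by
    intro ξ
    have hmem : A⁻¹ • ξ ∈ Metric.ball (0 : EuclideanSpace ℝ (Fin 3)) 1 ↔
        ξ ∈ Metric.ball (0 : EuclideanSpace ℝ (Fin 3)) A := by
      rw [mem_ball_zero_iff, mem_ball_zero_iff, norm_smul, norm_inv, Real.norm_of_nonneg hA.le,
        inv_mul_lt_iff₀ hA, mul_one]
    by_cases hξ : ξ ∈ Metric.ball (0 : EuclideanSpace ℝ (Fin 3)) A
    · rw [indicator_of_mem hξ, hh, indicator_of_mem (hmem.2 hξ), enorm_smul,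
        ENNReal.mul_rpow_of_ne_top enorm_ne_top enorm_ne_top,
        Real.enorm_eq_ofReal (inv_nonneg.2 hA.le), ENNReal.ofReal_rpow_of_pos (inv_pos.2 hA),
        Real.inv_rpow hA.le, ← Real.rpow_neg hA.le, neg_neg, ← mul_assoc, hAs, one_mul]
    · rw [indicator_of_notMem hξ, hh, indicator_of_notMem (mt hmem.1 hξ), mul_zero]
  calc ∫⁻ ξ in Metric.ball (0 : EuclideanSpace ℝ (Fin 3)) A, ‖ξ‖ₑ ^ (-(2 * s))
      = ∫⁻ ξ, (Metric.ball (0 : EuclideanSpace ℝ (Fin 3)) A).indicator (fun ξ => ‖ξ‖ₑ ^ (-(2 * s))) ξ :=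
        (lintegral_indicator measurableSet_ball _).symm
    _ = ∫⁻ ξ, ENNReal.ofReal (A ^ (-(2 * s))) * h (A⁻¹ • ξ) := lintegral_congr hpt
    _ = ENNReal.ofReal (A ^ (-(2 * s))) * ∫⁻ ξ, h (A⁻¹ • ξ) := lintegral_const_mul _ (hmeas.comp hsm)
    _ = ENNReal.ofReal (A ^ (-(2 * s))) *
          ∫⁻ η, h η ∂(Measure.map (fun ξ : EuclideanSpace ℝ (Fin 3) => A⁻¹ • ξ) volume) := by
        rw [lintegral_map hmeas hsm]
    _ = ENNReal.ofReal (A ^ (-(2 * s))) * (ENNReal.ofReal (A ^ 3) * ∫⁻ η, h η) := by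
        rw [Measure.map_addHaar_smul volume (inv_ne_zero hA.ne'), lintegral_smul_measure,
          finrank_euclideanSpace_fin, smul_eq_mul, inv_pow, inv_inv, abs_of_pos (pow_pos hA 3)]
    _ = ENNReal.ofReal (A ^ (3 - 2 * s)) *
          ∫⁻ ξ in Metric.ball (0 : EuclideanSpace ℝ (Fin 3)) 1, ‖ξ‖ₑ ^ (-(2 * s)) := by
        rw [← mul_assoc, ← ENNReal.ofReal_mul (Real.rpow_nonneg hA.le _), hh,
          lintegral_indicator measurableSet_ball]
        congr 2
        rw [← Real.rpow_natCast, ← Real.rpow_add hA]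
        congr 1
        push_cast
        ring

variable {F : Type*} [NormedAddCommGroup F]

/-- Cauchy–Schwarz for the low frequencies (Chemin–Xu 1997, (9)):
`∫_{‖ξ‖<A} ‖G‖ ≤ (∫_{‖ξ‖<A} ‖ξ‖^{−2s})^{1/2} (∫ ‖ξ‖^{2s} ‖G(ξ)‖² dξ)^{1/2}` (Mathlib
`ENNReal.lintegral_mul_le_Lp_mul_Lq`). [cite: CheminXu1997, Introduction (9), p. 723] -/
theorem lintegral_ball_enorm_le {G : EuclideanSpace ℝ (Fin 3) → F}
    (hG : AEStronglyMeasurable G volume) (A s : ℝ) :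
    ∫⁻ ξ in Metric.ball (0 : EuclideanSpace ℝ (Fin 3)) A, ‖G ξ‖ₑ ≤
      (∫⁻ ξ in Metric.ball (0 : EuclideanSpace ℝ (Fin 3)) A, ‖ξ‖ₑ ^ (-(2 * s))) ^ (1 / 2 : ℝ) *
        (∫⁻ ξ, ‖ξ‖ₑ ^ (2 * s) * ‖G ξ‖ₑ ^ 2) ^ (1 / 2 : ℝ) := by
  set μ : Measure (EuclideanSpace ℝ (Fin 3)) :=
    volume.restrict (Metric.ball (0 : EuclideanSpace ℝ (Fin 3)) A) with hμ
  have h0 : ∀ᵐ ξ ∂(volume : Measure (EuclideanSpace ℝ (Fin 3))), ξ ≠ 0 := by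
    rw [ae_iff]; simp [measure_singleton]
  set a : EuclideanSpace ℝ (Fin 3) → ℝ≥0∞ := fun ξ => ‖ξ‖ₑ ^ (-s) with ha_def
  set b : EuclideanSpace ℝ (Fin 3) → ℝ≥0∞ := fun ξ => ‖ξ‖ₑ ^ s * ‖G ξ‖ₑ with hb_def
  have ha : AEMeasurable a μ := (measurable_enorm.pow_const _).aemeasurable
  have hb : AEMeasurable b μ :=
    ((measurable_enorm.pow_const _).aemeasurable).mul hG.restrict.enorm
  have h1 : ∫⁻ ξ in Metric.ball (0 : EuclideanSpace ℝ (Fin 3)) A, ‖G ξ‖ₑ = ∫⁻ ξ, (a * b) ξ ∂μ := by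
    refine lintegral_congr_ae ((ae_restrict_of_ae h0).mono fun ξ hξ => ?_)
    have hx0 : (‖ξ‖ₑ : ℝ≥0∞) ≠ 0 := by simpa using hξ
    simp only [ha_def, hb_def, Pi.mul_apply]
    rw [← mul_assoc, ← ENNReal.rpow_add _ _ hx0 enorm_ne_top, neg_add_cancel, ENNReal.rpow_zero, one_mul]
  have h2 := ENNReal.lintegral_mul_le_Lp_mul_Lq μ Real.HolderConjugate.two_two ha hb
  have h3 : ∫⁻ ξ, a ξ ^ (2 : ℝ) ∂μ = ∫⁻ ξ in Metric.ball (0 : EuclideanSpace ℝ (Fin 3)) A, ‖ξ‖ₑ ^ (-(2 * s)) := by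
    refine lintegral_congr fun ξ => ?_
    simp only [ha_def]
    rw [← ENNReal.rpow_mul]
    congr 1
    ring
  have h4 : ∫⁻ ξ, b ξ ^ (2 : ℝ) ∂μ ≤ ∫⁻ ξ, ‖ξ‖ₑ ^ (2 * s) * ‖G ξ‖ₑ ^ 2 := by
    calc ∫⁻ ξ, b ξ ^ (2 : ℝ) ∂μ = ∫⁻ ξ in Metric.ball (0 : EuclideanSpace ℝ (Fin 3)) A,
          ‖ξ‖ₑ ^ (2 * s) * ‖G ξ‖ₑ ^ 2 := by
          refine lintegral_congr fun ξ => ?_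
          simp only [hb_def]
          rw [ENNReal.mul_rpow_of_nonneg _ _ (by norm_num : (0 : ℝ) ≤ 2), ← ENNReal.rpow_mul, ENNReal.rpow_two]
          congr 2
          ring
      _ ≤ ∫⁻ ξ, ‖ξ‖ₑ ^ (2 * s) * ‖G ξ‖ₑ ^ 2 := setLIntegral_le_lintegral _ _
  rw [h1]
  refine h2.trans ?_
  rw [h3]
  gcongr

/-- Low-frequency bound in dimension `3` (Chemin–Xu 1997, (9) with `d = 3`):
`∫_{‖ξ‖<A} ‖G‖ ≤ A^{(3−2s)/2} · J_s^{1/2} · (∫ ‖ξ‖^{2s} ‖G(ξ)‖² dξ)^{1/2}`, `J_s = ∫_{‖ξ‖<1} ‖ξ‖^{−2s} dξ`, for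
`A > 0`. [cite: CheminXu1997, Introduction (9), p. 723] -/
theorem lintegral_ball_enorm_le_mul {G : EuclideanSpace ℝ (Fin 3) → F}
    (hG : AEStronglyMeasurable G volume) {A : ℝ} (hA : 0 < A) (s : ℝ) :
    ∫⁻ ξ in Metric.ball (0 : EuclideanSpace ℝ (Fin 3)) A, ‖G ξ‖ₑ ≤
      ENNReal.ofReal (A ^ ((3 - 2 * s) / 2)) *
        (∫⁻ ξ in Metric.ball (0 : EuclideanSpace ℝ (Fin 3)) 1, ‖ξ‖ₑ ^ (-(2 * s))) ^ (1 / 2 : ℝ) *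
        (∫⁻ ξ, ‖ξ‖ₑ ^ (2 * s) * ‖G ξ‖ₑ ^ 2) ^ (1 / 2 : ℝ) := by
  refine (lintegral_ball_enorm_le hG A s).trans (le_of_eq ?_)
  rw [lintegral_ball_rpow_neg_eq hA, ENNReal.mul_rpow_of_nonneg _ _ (by norm_num : (0 : ℝ) ≤ 1 / 2),
    ENNReal.ofReal_rpow_of_nonneg (Real.rpow_nonneg hA.le _) (by norm_num), ← Real.rpow_mul hA.le]
  congr 4
  ring

end BallThree

end SobolevEmbeddingSub

end Literature.Analysis.FunctionSpaces

end
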